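/-
Solo seat `solo-Langlands-informed` (s10).  Kernel rung for PROPOSITION C, Step 2, of the seat's
Part IV (`run/shared/lean/ideation/Langlands/solo-informed/paper/CofiniteCompatibility.md`): the
hypothesis "`r̄(G_{F(ζ_ℓ)})` enormous" (ACC+ Def. 6.2.28, as typed in
`Literature.NumberTheory.GaloisRepresentations.EnormousSubgroup`; used by Allen–Newton, Doc. Math.
25 (2020), Thm 4.1 (2)) holds for dihedral-type images.  Elementary; no new mathematics claimed.
-/
import Mathlib
import Literature.NumberTheory.GaloisRepresentations.EnormousSubgroup

/-!
# Dihedral-type subgroups of `GL₂(k)` are enormous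

Let `k` be a field with `2 ≠ 0` and `H ≤ GL₂(k)` a finite subgroup of order prime to `ringChar k`
containing a diagonal `t = diag(a, d)` with `a ≠ d`, `a ≠ -d` (i.e. `a/d` of order `≥ 3`) and an
antidiagonal `h = antidiag(b, c)`.  Then `H` is enormous (`Subgroup.IsEnormous H`, ACC+ Def.
6.2.28): (1) and (2b) `H¹(H, ad⁰) = 0` because `|H|` is invertible in `k` (averaging);
(2a) `(ad⁰)^H = 0`; (3) every non-zero `H`-stable `W ⊆ ad⁰` contains a non-zero vector fixed by a
regular semisimple element of `H` — `D = diag(1,-1)` (fixed by `t`) if `W` has a `D`-component,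
else `E₁₂ + (c/b) E₂₁` or `E₂₁ + (b/c) E₁₂` (fixed by `h`) — by eigenvector extraction with `t`
(eigenvalues `1, a/d, d/a` on `D, E₁₂, E₂₁`, pairwise distinct).
Main result: `Summit.Langlands.Langlands.Theorems.isEnormous_of_diag_of_antidiag`.
-/

set_option linter.dupNamespace false

noncomputable section

open Matrix Polynomial
open Literature.NumberTheory.GaloisRepresentations
namespace Summit.Langlands.Langlands.Theorems

namespace DihedralEnormous

universe u

variable {k : Type u} [Field k]

/-- The trace-zero matrices `ad⁰ ⊆ M₂(k)` as a submodule (from the Literature file). -/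
abbrev ad0 (k : Type u) [Field k] : Submodule k (Matrix (Fin 2) (Fin 2) k) :=
  (adZero (Fin 2) k).toSubmodule

/-- `E₁₂ ∈ ad⁰`. -/
def e12 : ad0 k := ⟨!![0, 1; 0, 0], by rw [mem_adZero_toSubmodule_iff, trace_fin_two]; simp⟩
/-- `E₂₁ ∈ ad⁰`. -/
def e21 : ad0 k := ⟨!![0, 0; 1, 0], by rw [mem_adZero_toSubmodule_iff, trace_fin_two]; simp⟩
/-- `D = diag(1,-1) ∈ ad⁰`. -/
def dd : ad0 k := ⟨!![1, 0; 0, -1], by rw [mem_adZero_toSubmodule_iff, trace_fin_two]; simp⟩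

/-- Underlying matrix of `e12`. -/
@[simp] lemma e12_val : ((e12 : ad0 k) : Matrix (Fin 2) (Fin 2) k) = !![0, 1; 0, 0] := rfl
/-- Underlying matrix of `e21`. -/
@[simp] lemma e21_val : ((e21 : ad0 k) : Matrix (Fin 2) (Fin 2) k) = !![0, 0; 1, 0] := rfl
/-- Underlying matrix of `dd`. -/
@[simp] lemma dd_val : ((dd : ad0 k) : Matrix (Fin 2) (Fin 2) k) = !![1, 0; 0, -1] := rfl

/-- Every trace-zero `2 × 2` matrix is `w₀₀ D + w₀₁ E₁₂ + w₁₀ E₂₁`. -/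
lemma decomp (w : ad0 k) :
    w = (w.1 0 0) • (dd : ad0 k) + (w.1 0 1) • e12 + (w.1 1 0) • e21 := by
  have h := (mem_adZero_toSubmodule_iff w.1).1 w.2
  rw [trace_fin_two] at h
  apply Subtype.ext
  ext i j
  fin_cases i <;> fin_cases j <;> simp
  linear_combination h

variable {H : Subgroup (GL (Fin 2) k)}

/-- Matrix of an element of `H`. -/
abbrev mat (x : H) : Matrix (Fin 2) (Fin 2) k := ((x : GL (Fin 2) k) : Matrix (Fin 2) (Fin 2) k)

/-- If `x V = c • (V' x)` then `x • v = c • v'` in `ad⁰` (no inverse needs computing). -/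
lemma adZeroRep_apply_eq_smul (x : H) (v v' : ad0 k) (c : k)
    (hc : mat x * v.1 = c • (v'.1 * mat x)) :
    Subgroup.adZeroRep H x v = c • v' := by
  apply Subtype.ext
  rw [Subgroup.coe_adZeroRep_apply, Submodule.coe_smul]
  change mat x * v.1 * _ = c • v'.1
  rw [hc, Matrix.smul_mul, Matrix.mul_assoc, Units.mul_inv, Matrix.mul_one]

/-- If `x V = V x` then `x • v = v`. -/
lemma adZeroRep_apply_eq_self (x : H) (v : ad0 k) (hc : mat x * v.1 = v.1 * mat x) :
    Subgroup.adZeroRep H x v = v := by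
  have := adZeroRep_apply_eq_smul x v v 1 (by rw [one_smul]; exact hc)
  rwa [one_smul] at this

/-- Conversely `x • v = v` gives `x V = V x`. -/
lemma mul_eq_mul_of_apply_eq_self (x : H) (v : ad0 k) (h : Subgroup.adZeroRep H x v = v) :
    mat x * v.1 = v.1 * mat x := by
  have h' := congrArg Subtype.val h
  rw [Subgroup.coe_adZeroRep_apply] at h'
  change mat x * v.1 * _ = v.1 at h'
  calc mat x * v.1 = mat x * v.1 * (((x : GL (Fin 2) k)⁻¹ : GL (Fin 2) k) : Matrix (Fin 2) (Fin 2) k)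
        * mat x := by rw [Matrix.mul_assoc (mat x * v.1), Units.inv_mul, Matrix.mul_one]
    _ = v.1 * mat x := by rw [h']

/-- The determinant of an element of `H` is non-zero. -/
lemma det_mat_ne_zero (x : H) : (mat x).det ≠ 0 := by
  rw [← Matrix.GeneralLinearGroup.val_det_apply]
  exact Units.ne_zero _

section Elements

variable (t h0 : H)
variable (ht01 : mat t 0 1 = 0) (ht10 : mat t 1 0 = 0)
variable (hh00 : mat h0 0 0 = 0) (hh11 : mat h0 1 1 = 0)

include ht01 ht10 in
/-- A diagonal invertible matrix has non-zero diagonal entries. -/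
lemma t_ne_zero : mat t 0 0 ≠ 0 ∧ mat t 1 1 ≠ 0 := by
  have hdet := det_mat_ne_zero t
  rw [det_fin_two, ht01, ht10] at hdet
  exact ⟨fun h => hdet (by rw [h]; ring), fun h => hdet (by rw [h]; ring)⟩

include hh00 hh11 in
/-- An antidiagonal invertible matrix has non-zero antidiagonal entries. -/
lemma h_ne_zero : mat h0 0 1 ≠ 0 ∧ mat h0 1 0 ≠ 0 := by
  have hdet := det_mat_ne_zero h0
  rw [det_fin_two, hh00, hh11] at hdet
  exact ⟨fun h => hdet (by rw [h]; ring), fun h => hdet (by rw [h]; ring)⟩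

include ht01 ht10 in
/-- `t • D = D`. -/
lemma act_t_dd : Subgroup.adZeroRep H t dd = dd := by
  apply adZeroRep_apply_eq_self
  ext i j
  fin_cases i <;> fin_cases j <;>
    simp [-Matrix.cons_mul, Matrix.mul_apply, Fin.sum_univ_two, ht01, ht10]

include ht01 ht10 in
/-- `t • E₁₂ = (a/d) E₁₂`. -/
lemma act_t_e12 : Subgroup.adZeroRep H t e12 = (mat t 0 0 / mat t 1 1) • e12 := by
  have hd := (t_ne_zero t ht01 ht10).2
  apply adZeroRep_apply_eq_smul
  ext i j
  fin_cases i <;> fin_cases j <;>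
    (simp [-Matrix.cons_mul, Matrix.mul_apply, Fin.sum_univ_two, ht01, ht10]; try field_simp)

include ht01 ht10 in
/-- `t • E₂₁ = (d/a) E₂₁`. -/
lemma act_t_e21 : Subgroup.adZeroRep H t e21 = (mat t 1 1 / mat t 0 0) • e21 := by
  have ha := (t_ne_zero t ht01 ht10).1
  apply adZeroRep_apply_eq_smul
  ext i j
  fin_cases i <;> fin_cases j <;>
    (simp [-Matrix.cons_mul, Matrix.mul_apply, Fin.sum_univ_two, ht01, ht10]; try field_simp)

include hh00 hh11 in
/-- `h • E₁₂ = (c/b) E₂₁`. -/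
lemma act_h_e12 : Subgroup.adZeroRep H h0 e12 = (mat h0 1 0 / mat h0 0 1) • e21 := by
  have hb := (h_ne_zero h0 hh00 hh11).1
  apply adZeroRep_apply_eq_smul
  ext i j
  fin_cases i <;> fin_cases j <;>
    (simp [-Matrix.cons_mul, Matrix.mul_apply, Fin.sum_univ_two, hh00, hh11]; try field_simp)

include hh00 hh11 in
/-- `h • E₂₁ = (b/c) E₁₂`. -/
lemma act_h_e21 : Subgroup.adZeroRep H h0 e21 = (mat h0 0 1 / mat h0 1 0) • e12 := by
  have hc := (h_ne_zero h0 hh00 hh11).2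
  apply adZeroRep_apply_eq_smul
  ext i j
  fin_cases i <;> fin_cases j <;>
    (simp [-Matrix.cons_mul, Matrix.mul_apply, Fin.sum_univ_two, hh00, hh11]; try field_simp)

include ht01 ht10 in
/-- A diagonal element with distinct diagonal entries is regular semisimple. -/
lemma t_regular (htne : mat t 0 0 ≠ mat t 1 1) : IsRegularSemisimple (t : GL (Fin 2) k) := by
  rw [isRegularSemisimple_iff]
  change (mat t).charpoly.Separable
  have hfac : (mat t).charpoly = (X - C (mat t 0 0)) * (X - C (mat t 1 1)) := by
    rw [charpoly_fin_two, trace_fin_two, det_fin_two, ht01, ht10]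
    simp only [map_add, map_sub, map_mul, map_zero]
    ring
  rw [hfac]
  refine (separable_X_sub_C).mul separable_X_sub_C ?_
  have hne : mat t 0 0 - mat t 1 1 ≠ 0 := sub_ne_zero.2 htne
  refine ⟨-C ((mat t 0 0 - mat t 1 1)⁻¹), C ((mat t 0 0 - mat t 1 1)⁻¹), ?_⟩
  have : -C ((mat t 0 0 - mat t 1 1)⁻¹) * (X - C (mat t 0 0)) +
      C ((mat t 0 0 - mat t 1 1)⁻¹) * (X - C (mat t 1 1)) =
      C ((mat t 0 0 - mat t 1 1)⁻¹ * (mat t 0 0 - mat t 1 1)) := by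
    simp only [map_mul, map_sub]
    ring
  rw [this, inv_mul_cancel₀ hne, map_one]

include hh00 hh11 in
/-- An antidiagonal invertible element is regular semisimple when `2 ≠ 0`. -/
lemma h_regular (h2 : (2 : k) ≠ 0) : IsRegularSemisimple (h0 : GL (Fin 2) k) := by
  rw [isRegularSemisimple_iff]
  change (mat h0).charpoly.Separable
  obtain ⟨hb, hc⟩ := h_ne_zero h0 hh00 hh11
  have hfac : (mat h0).charpoly = X ^ 2 - C (mat h0 0 1 * mat h0 1 0) := by
    rw [charpoly_fin_two, trace_fin_two, det_fin_two, hh00, hh11]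
    simp only [map_add, map_sub, map_mul, map_zero]
    ring
  rw [hfac]
  exact separable_X_pow_sub_C _ (by exact_mod_cast h2) (mul_ne_zero hb hc)

end Elements
end DihedralEnormous

open DihedralEnormous

universe u

/-- **Dihedral-type subgroups of `GL₂(k)` are enormous.**  Let `k` be a field with `2 ≠ 0` and
`H ≤ GL₂(k)` a finite subgroup of order not divisible by `ringChar k`.  If `H` contains a
diagonal `t` with `t₀₀ ≠ t₁₁`, `t₀₀ ≠ -t₁₁` and an antidiagonal `h`, then `H` is enormous
(ACC+ Def. 6.2.28, `Subgroup.IsEnormous`).  Applied in Part IV (Prop. C, Step 2) to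
`H = r̄(G_{F(ζ_ℓ)})` for a residually dihedral `r̄` with `ψ` of order `≥ 3` on `H ∩ C`, in an
eigenbasis of the torus `C`. -/
theorem isEnormous_of_diag_of_antidiag {k : Type u} [Field k] (H : Subgroup (GL (Fin 2) k))
    [Finite H] (h2 : (2 : k) ≠ 0) (hp : ¬ ringChar k ∣ Nat.card H)
    (t h0 : GL (Fin 2) k) (htH : t ∈ H) (hhH : h0 ∈ H)
    (ht01 : (t : Matrix (Fin 2) (Fin 2) k) 0 1 = 0) (ht10 : (t : Matrix (Fin 2) (Fin 2) k) 1 0 = 0)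
    (htne : (t : Matrix (Fin 2) (Fin 2) k) 0 0 ≠ (t : Matrix (Fin 2) (Fin 2) k) 1 1)
    (htne' : (t : Matrix (Fin 2) (Fin 2) k) 0 0 ≠ -(t : Matrix (Fin 2) (Fin 2) k) 1 1)
    (hh00 : (h0 : Matrix (Fin 2) (Fin 2) k) 0 0 = 0) (hh11 : (h0 : Matrix (Fin 2) (Fin 2) k) 1 1 = 0) :
    Subgroup.IsEnormous H := by
  haveI : Fintype H := Fintype.ofFinite H
  set T : H := ⟨t, htH⟩ with hT
  set R : H := ⟨h0, hhH⟩ with hR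
  have hT01 : mat T 0 1 = 0 := ht01
  have hT10 : mat T 1 0 = 0 := ht10
  have hR00 : mat R 0 0 = 0 := hh00
  have hR11 : mat R 1 1 = 0 := hh11
  set a := (t : Matrix (Fin 2) (Fin 2) k) 0 0 with ha_def
  set d := (t : Matrix (Fin 2) (Fin 2) k) 1 1 with hd_def
  set b := (h0 : Matrix (Fin 2) (Fin 2) k) 0 1 with hb_def
  set c := (h0 : Matrix (Fin 2) (Fin 2) k) 1 0 with hc_def
  obtain ⟨ha, hd⟩ : a ≠ 0 ∧ d ≠ 0 := t_ne_zero T hT01 hT10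
  obtain ⟨hb, hc⟩ : b ≠ 0 ∧ c ≠ 0 := h_ne_zero R hR00 hR11
  have hcard : ((Fintype.card H : ℕ) : k) ≠ 0 := by
    intro h0'
    apply hp
    rw [Nat.card_eq_fintype_card]
    exact (ringChar.spec k _).1 h0'
  -- action facts
  have aTd : Subgroup.adZeroRep H T dd = dd := act_t_dd T hT01 hT10
  have aT12 : Subgroup.adZeroRep H T e12 = (a / d) • e12 := act_t_e12 T hT01 hT10
  have aT21 : Subgroup.adZeroRep H T e21 = (d / a) • e21 := act_t_e21 T hT01 hT10
  have aR12 : Subgroup.adZeroRep H R e12 = (c / b) • e21 := act_h_e12 R hR00 hR11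
  have aR21 : Subgroup.adZeroRep H R e21 = (b / c) • e12 := act_h_e21 R hR00 hR11
  -- scalar facts
  have hψ1 : a / d ≠ 1 := by rwa [Ne, div_eq_one_iff_eq hd]
  have hψ1' : d / a ≠ 1 := by rw [Ne, div_eq_one_iff_eq ha]; exact fun h => htne h.symm
  have hψψ : a / d - d / a ≠ 0 := by
    intro h
    have h' : a / d = d / a := sub_eq_zero.1 h
    rw [div_eq_div_iff hd ha] at h'
    have : (a - d) * (a + d) = 0 := by linear_combination h'
    rcases mul_eq_zero.1 this with h1 | h1
    · exact htne (sub_eq_zero.1 h1)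
    · exact htne' (eq_neg_of_add_eq_zero_left h1)
  refine ⟨?_, ?_, ?_, ?_⟩
  · -- (1) no `p`-power quotient
    intro N _ n hn
    by_contra hn0
    apply hp
    have h1 : ringChar k ∣ Nat.card (H ⧸ N) := by rw [hn]; exact dvd_pow_self _ hn0
    exact h1.trans (Subgroup.card_quotient_dvd_card N)
  · -- (2a) `H⁰(H, ad⁰) = 0`
    rw [Submodule.eq_bot_iff]
    intro w hw
    rw [Representation.mem_invariants] at hw
    have h1 := mul_eq_mul_of_apply_eq_self T w (hw T)
    have h1' := mul_eq_mul_of_apply_eq_self R w (hw R)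
    have e01 := congrFun (congrFun h1 0) 1
    have e10 := congrFun (congrFun h1 1) 0
    have f01 := congrFun (congrFun h1' 0) 1
    simp only [Matrix.mul_apply, Fin.sum_univ_two, hT01, hT10, hR00, hR11, zero_mul, mul_zero,
      add_zero, zero_add] at e01 e10 f01
    have tr := (mem_adZero_toSubmodule_iff w.1).1 w.2
    rw [trace_fin_two] at tr
    -- e01 : a * w01 = w01 * d ; e10 : d * w10 = w10 * a ; f01 : b * w11 = w00 * b
    have hw01 : w.1 0 1 = 0 := (mul_eq_zero.1 (by linear_combination e01 :
      (a - d) * w.1 0 1 = 0)).resolve_left (sub_ne_zero.2 htne)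
    have hw10 : w.1 1 0 = 0 := (mul_eq_zero.1 (by linear_combination e10 :
      (d - a) * w.1 1 0 = 0)).resolve_left (sub_ne_zero.2 htne.symm)
    have hw00 : w.1 0 0 = 0 := (mul_eq_zero.1 (by linear_combination b * tr - f01 :
      (2 * b) * w.1 0 0 = 0)).resolve_left (mul_ne_zero h2 hb)
    have hw11 : w.1 1 1 = 0 := by linear_combination tr - hw00
    apply Subtype.ext
    ext i j
    fin_cases i <;> fin_cases j <;> simp [hw00, hw01, hw10, hw11]
  · -- (2b) `H¹(H, ad⁰) = 0` by averaging
    intro f hf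
    rw [groupCohomology.mem_cocycles₁_iff] at hf
    have key : ∀ g : H, ((Fintype.card H : ℕ) : k) • f g =
        (∑ x : H, f x) - (Rep.of (Subgroup.adZeroRep H)).ρ g (∑ x : H, f x) := by
      intro g
      have h1 : ∑ x : H, f (g * x) = ∑ x : H, f x :=
        Fintype.sum_equiv (Equiv.mulLeft g) _ _ (fun x => rfl)
      have h2' : ∑ x : H, f (g * x) =
          (Rep.of (Subgroup.adZeroRep H)).ρ g (∑ x : H, f x) + (Fintype.card H) • f g := by
        simp_rw [hf]
        rw [Finset.sum_add_distrib, map_sum, Finset.sum_const, Finset.card_univ]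
      rw [h1] at h2'
      rw [Nat.cast_smul_eq_nsmul]
      exact eq_sub_of_add_eq' h2'.symm
    refine LinearMap.mem_range.2 ⟨-((((Fintype.card H : ℕ) : k))⁻¹ • ∑ x : H, f x), ?_⟩
    funext g
    rw [groupCohomology.d₀₁_hom_apply, map_neg, map_smul, neg_sub_neg]
    have e1 := (smul_sub ((((Fintype.card H : ℕ) : k))⁻¹) (∑ x : H, f x)
      ((Rep.of (Subgroup.adZeroRep H)).ρ g (∑ x : H, f x))).symm
    rw [e1, ← key g, inv_smul_smul₀ hcard]
  · -- (3) regular semisimple elements with fixed vectors on every simple submodule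
    intro W hW
    -- a non-zero vector of `W`
    obtain ⟨w, hwW, hw0⟩ : ∃ w ∈ W.toSubmodule, w ≠ 0 := by
      by_contra hcon
      push Not at hcon
      apply hW.1
      apply Subrepresentation.toSubmodule_injective
      change W.toSubmodule = ⊥
      rw [Submodule.eq_bot_iff]
      exact hcon
    have memT : ∀ v ∈ W.toSubmodule, Subgroup.adZeroRep H T v ∈ W.toSubmodule :=
      fun v hv => W.apply_mem_toSubmodule T hv
    have memR : ∀ v ∈ W.toSubmodule, Subgroup.adZeroRep H R v ∈ W.toSubmodule :=
      fun v hv => W.apply_mem_toSubmodule R hv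
    have hdec := decomp w
    set α := w.1 0 0 with hα
    set β := w.1 0 1 with hβ
    set γ := w.1 1 0 with hγ
    -- the two `h`-fixed candidates
    have fix12 : Subgroup.adZeroRep H R (e12 + (c / b) • e21) = e12 + (c / b) • e21 := by
      rw [map_add, map_smul, aR12, aR21, smul_smul,
        show c / b * (b / c) = 1 by field_simp, one_smul, add_comm]
    have fix21 : Subgroup.adZeroRep H R (e21 + (b / c) • e12) = e21 + (b / c) • e12 := by
      rw [map_add, map_smul, aR12, aR21, smul_smul,
        show b / c * (c / b) = 1 by field_simp, one_smul, add_comm]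
    have ne12 : (e12 + (c / b) • e21 : ad0 k) ≠ 0 := by
      intro h
      have := congrArg (fun M : ad0 k => M.1 0 1) h
      simp at this
    have ne21 : (e21 + (b / c) • e12 : ad0 k) ≠ 0 := by
      intro h
      have := congrArg (fun M : ad0 k => M.1 1 0) h
      simp at this
    have hregT : IsRegularSemisimple (T : GL (Fin 2) k) := t_regular T hT01 hT10 htne
    have hregR : IsRegularSemisimple (R : GL (Fin 2) k) := h_regular R hR00 hR11 h2
    by_cases hα0 : α ≠ 0
    · -- `D ∈ W`, fixed by `t`
      have hu1 : Subgroup.adZeroRep H T w - (a / d) • w ∈ W.toSubmodule :=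
        W.toSubmodule.sub_mem (memT w hwW) (W.toSubmodule.smul_mem _ hwW)
      have hu2 : Subgroup.adZeroRep H T (Subgroup.adZeroRep H T w - (a / d) • w)
          - (d / a) • (Subgroup.adZeroRep H T w - (a / d) • w) ∈ W.toSubmodule :=
        W.toSubmodule.sub_mem (memT _ hu1) (W.toSubmodule.smul_mem _ hu1)
      have hval : Subgroup.adZeroRep H T (Subgroup.adZeroRep H T w - (a / d) • w)
          - (d / a) • (Subgroup.adZeroRep H T w - (a / d) • w)
          = (α * (1 - a / d) * (1 - d / a)) • (dd : ad0 k) := by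
        conv_lhs => rw [hdec]
        simp only [map_add, map_sub, map_smul, aTd, aT12, aT21]
        module
      rw [hval] at hu2
      have hcoef : α * (1 - a / d) * (1 - d / a) ≠ 0 :=
        mul_ne_zero (mul_ne_zero hα0 (sub_ne_zero.2 hψ1.symm)) (sub_ne_zero.2 hψ1'.symm)
      have hD : (dd : ad0 k) ∈ W.toSubmodule := (Submodule.smul_mem_iff _ hcoef).1 hu2
      refine ⟨T, hregT, dd, hD, ?_, aTd⟩
      intro h
      have := congrArg (fun M : ad0 k => M.1 0 0) h
      simp at this
    · push Not at hα0
      by_cases hβ0 : β ≠ 0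
      · -- `E₁₂ ∈ W`, then `E₁₂ + (c/b) E₂₁ ∈ W` is fixed by `h`
        have hv : Subgroup.adZeroRep H T w - (d / a) • w ∈ W.toSubmodule :=
          W.toSubmodule.sub_mem (memT w hwW) (W.toSubmodule.smul_mem _ hwW)
        have hval : Subgroup.adZeroRep H T w - (d / a) • w = (β * (a / d - d / a)) • (e12 : ad0 k) := by
          conv_lhs => rw [hdec]
          rw [hα0]
          simp only [map_add, map_smul, aT12, aT21, zero_smul, zero_add]
          module
        rw [hval] at hv
        have h12 : (e12 : ad0 k) ∈ W.toSubmodule :=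
          (Submodule.smul_mem_iff _ (mul_ne_zero hβ0 hψψ)).1 hv
        have h21 : (c / b) • (e21 : ad0 k) ∈ W.toSubmodule := by
          have := memR _ h12
          rwa [aR12] at this
        exact ⟨R, hregR, e12 + (c / b) • e21, W.toSubmodule.add_mem h12 h21, ne12, fix12⟩
      · push Not at hβ0
        by_cases hγ0 : γ ≠ 0
        · -- `E₂₁ ∈ W`, then `E₂₁ + (b/c) E₁₂ ∈ W` is fixed by `h`
          have hval : w = γ • (e21 : ad0 k) := by
            conv_lhs => rw [hdec]
            rw [hα0, hβ0, zero_smul, zero_smul, zero_add, zero_add]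
          have h21 : (e21 : ad0 k) ∈ W.toSubmodule := by
            rw [hval] at hwW
            exact (Submodule.smul_mem_iff _ hγ0).1 hwW
          have h12 : (b / c) • (e12 : ad0 k) ∈ W.toSubmodule := by
            have := memR _ h21
            rwa [aR21] at this
          exact ⟨R, hregR, e21 + (b / c) • e12, W.toSubmodule.add_mem h21 h12, ne21, fix21⟩
        · push Not at hγ0
          exfalso
          apply hw0
          rw [hdec, hα0, hβ0, hγ0, zero_smul, zero_smul, zero_smul, zero_add, zero_add]

end Summit.Langlands.Langlands.Theorems
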